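import Mathlib.Topology.UniformSpace.HeineCantor
import Literature.Analysis.FluidPDE.CompressibleEulerImplosionTriangle
import Literature.Analysis.FluidPDE.CompressibleEulerImplosionODEEscape
import HarnessLib

/-!
# Buckmaster–Cao-Labora–Gómez-Serrano at `γ = 5/3`: trajectories trapped in `𝒯^{(H)}` reach `P_s`

Topic `Literature/Analysis/FluidPDE`; namespace
`Literature.Analysis.FluidPDE.BuckmasterCaolaboraGomezserrano2025.Monatomic`. Companion of
`CompressibleEulerImplosion.lean` (named fact `BuckmasterCaolaboraGomezserrano2025_thm11_monatomic`,
THEOREM 1.1 of T. Buckmaster, G. Cao-Labora, J. Gómez-Serrano, *Smooth imploding solutions for 3D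
compressible fluids*, Forum Math. Pi 13 (2025) e6, arXiv:2208.09445, at `γ = 5/3`, `α = 1/3`);
sequel of `CompressibleEulerImplosionTriangle.lean` (the triangle `𝒯^{(H)}` is forward invariant,
`W` decreases) and `CompressibleEulerImplosionODEEscape.lean` (maximal solutions leave compacts).

Brick D2-arrive of the discharge plan — the concluding step of Proposition 2.5: "Using
Proposition 1.6, the fact that `𝒯^{(H)}` is bounded and that there are no equilibrium points in
`𝒯^{(H)}`, the trajectory has to come from `P_s`." Here this is proved at `γ = 5/3` WITHOUT the
limit-set trichotomy of Proposition 1.6, by an argument specific to the triangle: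
* a solution of (1.8) cannot stay in `𝒯^{(H)} ∖ {D_Z = 0}` for all forward times, because there
  `W′ = N_W/D_W ≤ N_W(P_s)/(D_W(P_s) + 2H/3) < 0` (`not_forall_hasDerivAt_of_tri`);
* a solution on `[a, b)` in `𝒯^{(H)} ∖ {D_Z = 0}` admitting no extension off the sonic lines
  converges to `P_s` as `ξ → b⁻` (`tendsto_Ps_of_maximal`): by the escape lemma `D_Z(c(ξ)) → 0⁻`;
  if `W − W₀` stayed `≥ ε₀`, the curve would approach the part of the edge `{D_Z = 0}` at distance
  `≥ ε₀` from `P_s`, where `N_Z ≥ ½(ε₀/2)(ε₀/2 + 2q) > 0` (Lemma 9.22), forcing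
  `(D_Z ∘ c)′ = (N_W/D_W + 2N_Z/D_Z)/3 < 0` near the edge — incompatible with `D_Z ∘ c ↑ 0`; so
  `W − W₀ → 0`, and `|Z − Z₀| ≤ W − W₀` on the triangle.
Theorems only. [cite: BuckmasterCaolaboraGomezserrano2025, Prop. 2.5 (proof), Remark 2.6, Lemma 9.22]
-/

noncomputable section

open Set Filter Metric Topology

namespace Literature.Analysis.FluidPDE

namespace BuckmasterCaolaboraGomezserrano2025

namespace Monatomic

open ODE

variable {r : ℝ}

/-! ### No complete forward trajectory inside the triangle -/

/-- On `𝒯^{(H)}` (with `D_Z ≠ 0`) the `W`-component of the field is uniformly negative: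
`N_W/D_W ≤ N_W(P_s)/(D_W(P_s) + 2H/3) < 0`. [cite: BuckmasterCaolaboraGomezserrano2025, Remark 2.6, Lemma 9.16] -/
theorem field_fst_le_of_tri (hr : r < rstar) {H : ℝ} {p : ℝ × ℝ} (hp : p ∈ tri r H) :
    (field r p).1 ≤ NW r (W0 r) (Z0 r) / (DW (W0 r) (Z0 r) + 2 * H / 3) := by
  have hr2 : r < 2 := by linarith [rstar_lt]
  obtain ⟨h1, h2, h3⟩ := hp
  have hDW : 0 < DW p.1 p.2 := DW_pos_of_triangle hr2 h2 h3
  have hDWle : DW p.1 p.2 ≤ DW (W0 r) (Z0 r) + 2 * H / 3 := DW_le_of_triangle h1 h2 h3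
  have hNW : NW r p.1 p.2 ≤ NW r (W0 r) (Z0 r) := NW_le_of_triangle hr h2 h3
  have hN0 : NW r (W0 r) (Z0 r) < 0 := NW_Ps_neg hr
  have hM : 0 < DW (W0 r) (Z0 r) + 2 * H / 3 := by linarith [DW_Ps_pos hr2]
  show NW r p.1 p.2 / DW p.1 p.2 ≤ NW r (W0 r) (Z0 r) / (DW (W0 r) (Z0 r) + 2 * H / 3)
  rw [div_le_div_iff₀ hDW hM]
  nlinarith

/-- **No complete forward trajectory in the triangle** (Remark 2.6 made quantitative): a solution
of (1.8) defined for all `ξ ≥ a`, off the sonic line `D_Z = 0`, cannot start in `𝒯^{(H)}` — its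
`W`-component would decrease at least linearly, below `W₀`.
[cite: BuckmasterCaolaboraGomezserrano2025, Prop. 2.5 (proof), Remark 2.6] -/
theorem not_forall_hasDerivAt_of_tri (h1 : 1 < r) (hr : r < rstar) (H : ℝ) {c : ℝ → ℝ × ℝ} {a : ℝ}
    (hc : ∀ ξ ∈ Ici a, HasDerivAt c (field r (c ξ)) ξ)
    (hDZ : ∀ ξ ∈ Ici a, DZ (c ξ).1 (c ξ).2 ≠ 0) (h0 : c a ∈ tri r H) : False := by
  -- the solution stays in the triangle
  have hin : ∀ ξ ∈ Ici a, c ξ ∈ tri r H := by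
    intro ξ hξ
    have h := triangle_invariant h1 hr H (b := ξ + 1) (fun t ht => hc t ht.1) (fun t ht => hDZ t ht.1)
      h0 ξ ⟨hξ, by linarith⟩
    exact ⟨h.1, h.2.1, h.2.2.le⟩
  set κ : ℝ := -(NW r (W0 r) (Z0 r) / (DW (W0 r) (Z0 r) + 2 * H / 3)) with hκ
  have hr2 : r < 2 := by linarith [rstar_lt]
  have hκpos : 0 < κ := by
    have hM : 0 < DW (W0 r) (Z0 r) + 2 * H / 3 := by
      have h1' := DW_le_of_triangle h0.1 h0.2.1 h0.2.2
      have h2' := DW_pos_of_triangle hr2 h0.2.1 h0.2.2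
      linarith
    exact neg_pos.mpr (div_neg_of_neg_of_pos (NW_Ps_neg hr) hM)
  -- `φ(ξ) = W(ξ) + κ ξ` is non-increasing on `[a, ∞)`
  have hc1 : ∀ ξ ∈ Ici a, HasDerivAt (fun s => (c s).1) (field r (c ξ)).1 ξ := fun ξ hξ => (hc ξ hξ).fst
  have hφ : ∀ ξ ∈ Ici a, HasDerivAt (fun s => (c s).1 + κ * s) ((field r (c ξ)).1 + κ) ξ :=
    fun ξ hξ => by
      have h : HasDerivAt (fun s => (c s).1 + κ * s) ((field r (c ξ)).1 + κ * 1) ξ :=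
        (hc1 ξ hξ).add ((hasDerivAt_id' ξ).const_mul κ)
      exact h.congr_deriv (by ring)
  have hanti : AntitoneOn (fun s => (c s).1 + κ * s) (Ici a) := by
    refine antitoneOn_of_deriv_nonpos (convex_Ici a)
      (fun ξ hξ => (hφ ξ hξ).continuousAt.continuousWithinAt)
      (fun ξ hξ => (hφ ξ (interior_subset hξ)).differentiableAt.differentiableWithinAt) ?_
    intro ξ hξ
    have hξ' : ξ ∈ Ici a := interior_subset hξ
    rw [(hφ ξ hξ').deriv]
    have := field_fst_le_of_tri hr (hin ξ hξ')
    linarith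
  -- evaluate at `ξ₁ = a + ((c a).1 - W0 r + 1)/κ`
  set ξ₁ : ℝ := a + ((c a).1 - W0 r + 1) / κ with hξ₁
  have hu0 : 0 ≤ (c a).1 - W0 r := (triangle_uv h0.2.1 h0.2.2).1
  have haξ₁ : a ≤ ξ₁ := by
    have : 0 ≤ ((c a).1 - W0 r + 1) / κ := div_nonneg (by linarith) hκpos.le
    linarith
  have hle := hanti (self_mem_Ici : a ∈ Ici a) (haξ₁ : ξ₁ ∈ Ici a) haξ₁
  simp only at hle
  have hu1 : 0 ≤ (c ξ₁).1 - W0 r := (triangle_uv (hin ξ₁ haξ₁).2.1 (hin ξ₁ haξ₁).2.2).1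
  have hprod : κ * ξ₁ = κ * a + ((c a).1 - W0 r + 1) := by
    simp only [hξ₁]; field_simp
  nlinarith

/-! ### The distance to `P_s` is controlled by `W − W₀` -/

/-- On the triangle, `dist(p, P_s) ≤ W − W₀` (sup distance on `ℝ²`; `|Z − Z₀| ≤ W − W₀`).
[folklore] -/
theorem dist_Ps_le_of_tri {H : ℝ} {p : ℝ × ℝ} (hp : p ∈ tri r H) :
    dist p (W0 r, Z0 r) ≤ p.1 - W0 r := by
  obtain ⟨_, h2, h3⟩ := hp
  obtain ⟨hu, hv, hv1, _⟩ := triangle_uv h2 h3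
  rw [Prod.dist_eq, Real.dist_eq, Real.dist_eq, max_le_iff, abs_le, abs_le]
  exact ⟨⟨by linarith, by linarith⟩, ⟨by linarith, by linarith⟩⟩

/-! ### `N_Z` is positive near the sonic edge away from `P_s` -/

/-- On the sonic edge of the triangle at horizontal distance `≥ ε₀` from `P_s`,
`N_Z ≥ ½(ε₀/2)(ε₀/2 + 2q)`. [cite: BuckmasterCaolaboraGomezserrano2025, Lemma 9.22] -/
theorem NZ_ge_of_edge (hr : r < rstar) {ε₀ : ℝ} (hε₀ : 0 < ε₀) {p : ℝ × ℝ}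
    (hD : DZ p.1 p.2 = 0) (hu : ε₀ ≤ p.1 - W0 r) :
    1 / 2 * (ε₀ / 2) * (ε₀ / 2 + 2 * q r) ≤ NZ r p.1 p.2 := by
  have hline : p.1 = -3 - 2 * p.2 := by unfold DZ at hD; linarith
  have hv : p.2 - Z0 r ≤ -(ε₀ / 2) := by
    have e := DZ_eq_uv r p.1 p.2
    rw [hD] at e
    linarith
  have hq := q_pos hr
  have key : NZ r p.1 p.2 = 1 / 2 * (p.2 - Z0 r) * (p.2 - Z0bar r) := by
    rw [hline]; exact NZ_on_sonicLine (disc_pos hr).le p.2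
  have hbar : p.2 - Z0bar r = (p.2 - Z0 r) - 2 * q r := by unfold Z0 Z0bar; ring
  rw [key, hbar]
  nlinarith [mul_le_mul_of_nonneg_left hv hε₀.le, mul_nonneg hε₀.le hq.le]

/-! ### Arrival at `P_s` -/

/-- **Proposition 2.5, the arrival step, at `γ = 5/3`.** Let `1 < r < r*`, `H ∈ ℝ`, and let
`c = (W, Z)` solve (1.8) on `[a, b)` (`a < b`), off the sonic line `D_Z = 0`, with `c(a) ∈ 𝒯^{(H)}`,
and suppose `c` admits no extension to a solution on a longer interval `(a, b')` with values off
both sonic lines. Then `c(ξ) → P_s` as `ξ → b⁻`.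
[cite: BuckmasterCaolaboraGomezserrano2025, Prop. 2.5 (proof)] -/
theorem tendsto_Ps_of_maximal (h1 : 1 < r) (hr : r < rstar) (H : ℝ) {c : ℝ → ℝ × ℝ} {a b : ℝ}
    (hab : a < b) (hc : ∀ ξ ∈ Ico a b, HasDerivAt c (field r (c ξ)) ξ)
    (hDZ : ∀ ξ ∈ Ico a b, DZ (c ξ).1 (c ξ).2 ≠ 0) (h0 : c a ∈ tri r H)
    (hmax : ∀ (c' : ℝ → ℝ × ℝ) (b' : ℝ), b < b' → EqOn c' c (Ioo a b) →
      (∀ ξ ∈ Ioo a b', HasDerivAt c' (field r (c' ξ)) ξ) → ¬ ∀ ξ ∈ Ioo a b', c' ξ ∈ offSonic) :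
    Tendsto c (𝓝[<] b) (𝓝 (W0 r, Z0 r)) := by
  have hr2 : r < 2 := by linarith [rstar_lt]
  have hin' := triangle_invariant h1 hr H hc hDZ h0
  have hin : ∀ ξ ∈ Ico a b, c ξ ∈ tri r H := fun ξ hξ =>
    ⟨(hin' ξ hξ).1, (hin' ξ hξ).2.1, (hin' ξ hξ).2.2.le⟩
  have hDneg : ∀ ξ ∈ Ico a b, DZ (c ξ).1 (c ξ).2 < 0 := fun ξ hξ => (hin' ξ hξ).2.2
  have hanti := (triangle_W_strictAnti h1 hr H hc hDZ ⟨h0.1, h0.2.1, h0.2.2⟩).2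
  -- Step 1: it suffices that `W - W₀` becomes small
  suffices hsmall : ∀ ε > (0 : ℝ), ∃ ξ₁ ∈ Ico a b, (c ξ₁).1 - W0 r < ε by
    rw [Metric.tendsto_nhds]
    intro ε hε
    obtain ⟨ξ₁, hξ₁, hlt⟩ := hsmall ε hε
    filter_upwards [Ioo_mem_nhdsLT hξ₁.2] with ξ hξ
    have hξ' : ξ ∈ Ico a b := ⟨hξ₁.1.trans hξ.1.le, hξ.2⟩
    have hW : (c ξ).1 < (c ξ₁).1 := hanti hξ₁ hξ' hξ.1
    exact (dist_Ps_le_of_tri (hin ξ hξ')).trans_lt (by linarith)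
  -- Step 2: suppose not
  by_contra hcon
  push Not at hcon
  obtain ⟨ε₀, hε₀, hbig⟩ := hcon
  -- the compact trapezoid `Q`
  set Q : Set (ℝ × ℝ) := tri r H ∩ {p | ε₀ ≤ p.1 - W0 r} with hQ
  have hQc : IsCompact Q :=
    (isCompact_tri r H).inter_right (isClosed_le continuous_const (by fun_prop))
  have hcQ : ∀ ξ ∈ Ico a b, c ξ ∈ Q := fun ξ hξ => ⟨hin ξ hξ, hbig ξ hξ⟩
  -- `N_Z ≥ n₁` on the sonic edge of `Q`, `N_Z > n₁/2` near it
  set n₁ : ℝ := 1 / 2 * (ε₀ / 2) * (ε₀ / 2 + 2 * q r) with hn₁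
  have hn₁ : 0 < n₁ := by have := q_pos hr; positivity
  obtain ⟨δ₁, hδ₁, hUC⟩ := Metric.uniformContinuousOn_iff.mp
    (hQc.uniformContinuousOn_of_continuous (continuous_NZ r).continuousOn) (n₁ / 2) (by linarith)
  have hnear : ∀ p ∈ Q, -(2 / 3 * δ₁) < DZ p.1 p.2 → n₁ / 2 < NZ r p.1 p.2 := by
    intro p hp hd
    obtain ⟨⟨k1, k2, k3⟩, k4⟩ := hp
    -- vertical projection onto the sonic line
    set p' : ℝ × ℝ := (p.1, p.2 - 3 / 2 * DZ p.1 p.2) with hp'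
    have hD' : DZ p'.1 p'.2 = 0 := by simp only [hp']; unfold DZ; ring
    have hp'Q : p' ∈ Q := by
      refine ⟨⟨k1, ?_, hD'.le⟩, k4⟩
      simp only [hp']
      nlinarith
    have hdist : dist p p' < δ₁ := by
      rw [Prod.dist_eq, dist_self, Real.dist_eq]
      have : |p.2 - (p.2 - 3 / 2 * DZ p.1 p.2)| = -(3 / 2 * DZ p.1 p.2) := by
        rw [show p.2 - (p.2 - 3 / 2 * DZ p.1 p.2) = 3 / 2 * DZ p.1 p.2 by ring,
          abs_of_nonpos (by nlinarith)]
      rw [this, max_lt_iff]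
      exact ⟨hδ₁, by linarith⟩
    have h1' := hUC p ⟨⟨k1, k2, k3⟩, k4⟩ p' hp'Q hdist
    rw [Real.dist_eq] at h1'
    have h2' : n₁ ≤ NZ r p'.1 p'.2 := NZ_ge_of_edge hr hε₀ hD' k4
    have := (abs_sub_lt_iff.mp h1').2
    linarith
  set η : ℝ := 2 / 3 * δ₁ with hη
  have hηpos : 0 < η := by positivity
  -- the derivative of `D = D_Z ∘ c`
  set D : ℝ → ℝ := fun ξ => DZ (c ξ).1 (c ξ).2 with hDdef
  have hDd : ∀ ξ ∈ Ico a b,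
      HasDerivAt D (((field r (c ξ)).1 + 2 * (field r (c ξ)).2) / 3) ξ := fun ξ hξ => by
    have hc1 : HasDerivAt (fun s => (c s).1) (field r (c ξ)).1 ξ := (hc ξ hξ).fst
    have hc2 : HasDerivAt (fun s => (c s).2) (field r (c ξ)).2 ξ := (hc ξ hξ).snd
    have h := ((hc1.add (hc2.const_mul 2)).div_const 3).const_add 1
    have e : D = fun ξ => 1 + ((c ξ).1 + 2 * (c ξ).2) / 3 := by
      funext ξ; simp only [hDdef]; unfold DZ; ring
    rw [e]; exact h
  have hD'neg : ∀ ξ ∈ Ico a b, -η < D ξ →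
      ((field r (c ξ)).1 + 2 * (field r (c ξ)).2) / 3 < 0 := by
    intro ξ hξ hDξ
    have hsg := (triangle_W_strictAnti h1 hr H hc hDZ ⟨h0.1, h0.2.1, h0.2.2⟩).1 ξ hξ
    have hW' : (field r (c ξ)).1 < 0 := by
      show NW r (c ξ).1 (c ξ).2 / DW (c ξ).1 (c ξ).2 < 0
      exact div_neg_of_neg_of_pos hsg.2.2 hsg.2.1
    have hNZ : n₁ / 2 < NZ r (c ξ).1 (c ξ).2 := hnear (c ξ) (hcQ ξ hξ) hDξ
    have hZ' : (field r (c ξ)).2 < 0 := by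
      show NZ r (c ξ).1 (c ξ).2 / DZ (c ξ).1 (c ξ).2 < 0
      exact div_neg_of_pos_of_neg (by linarith) hsg.1
    linarith
  -- escape: `D` eventually exceeds `-δ`, for every `δ > 0`
  have hesc : ∀ δ > (0 : ℝ), ∃ τ > (0 : ℝ), ∀ ξ ∈ Ioo a b, b - τ < ξ → -δ < D ξ := by
    intro δ hδ
    set K : Set (ℝ × ℝ) := Q ∩ {p | DZ p.1 p.2 ≤ -δ} with hK
    have hKc : IsCompact K := hQc.inter_right (isClosed_le continuous_DZ continuous_const)
    have hKU : K ⊆ offSonic := fun p hp =>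
      mem_offSonic_of_tri hr2 hp.1.1 (by have := hp.2; simp only [mem_setOf_eq] at this; linarith)
    obtain ⟨τ, hτ, hout⟩ := eventually_not_mem_of_maximal (F := field r) isOpen_offSonic
      (fun p hp => contDiffAt_field_of_mem hp) hKc hKU
      (fun ξ hξ => hc ξ ⟨hξ.1.le, hξ.2⟩)
      (fun ξ hξ => mem_offSonic_of_tri hr2 (hin ξ ⟨hξ.1.le, hξ.2⟩) (hDZ ξ ⟨hξ.1.le, hξ.2⟩)) hmax
    refine ⟨τ, hτ, fun ξ hξ hbξ => ?_⟩
    have hnot := hout ξ hξ hbξ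
    by_contra hle
    exact hnot ⟨hcQ ξ ⟨hξ.1.le, hξ.2⟩, by simp only [mem_setOf_eq]; linarith⟩
  -- the contradiction
  obtain ⟨τ₁, hτ₁, hτ₁D⟩ := hesc η hηpos
  set ξ₁ : ℝ := max (a + (b - a) / 2) (b - τ₁ / 2) with hξ₁
  have hξ₁ab : ξ₁ ∈ Ioo a b := ⟨lt_of_lt_of_le (by linarith) (le_max_left _ _),
    max_lt (by linarith) (by linarith)⟩
  have hξ₁τ : b - τ₁ < ξ₁ := lt_of_lt_of_le (by linarith) (le_max_right _ _)
  -- `D` is strictly decreasing on `[ξ₁, b)`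
  have hDanti : StrictAntiOn D (Ico ξ₁ b) := by
    refine strictAntiOn_of_deriv_neg (convex_Ico ξ₁ b)
      (fun ξ hξ => (hDd ξ ⟨hξ₁ab.1.le.trans hξ.1, hξ.2⟩).continuousAt.continuousWithinAt) ?_
    intro ξ hξ
    rw [interior_Ico] at hξ
    have hξab : ξ ∈ Ico a b := ⟨(hξ₁ab.1.trans hξ.1).le, hξ.2⟩
    rw [(hDd ξ hξab).deriv]
    exact hD'neg ξ hξab (hτ₁D ξ ⟨hξ₁ab.1.trans hξ.1, hξ.2⟩ (hξ₁τ.trans hξ.1))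
  have hD₁ : D ξ₁ < 0 := hDneg ξ₁ ⟨hξ₁ab.1.le, hξ₁ab.2⟩
  obtain ⟨τ₂, hτ₂, hτ₂D⟩ := hesc (-D ξ₁) (by linarith)
  set ξ₂ : ℝ := max (ξ₁ + (b - ξ₁) / 2) (b - τ₂ / 2) with hξ₂
  have hξ₂b : ξ₂ < b := max_lt (by linarith [hξ₁ab.2]) (by linarith)
  have hξ₁₂ : ξ₁ < ξ₂ := lt_of_lt_of_le (by linarith [hξ₁ab.2]) (le_max_left _ _)
  have hξ₂τ : b - τ₂ < ξ₂ := lt_of_lt_of_le (by linarith) (le_max_right _ _)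
  have hlt : D ξ₂ < D ξ₁ := hDanti ⟨le_rfl, hξ₁ab.2⟩ ⟨hξ₁₂.le, hξ₂b⟩ hξ₁₂
  have hgt : -(-D ξ₁) < D ξ₂ := hτ₂D ξ₂ ⟨hξ₁ab.1.trans hξ₁₂, hξ₂b⟩ hξ₂τ
  linarith

end Monatomic

end BuckmasterCaolaboraGomezserrano2025

end Literature.Analysis.FluidPDE
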